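import Literature.Computability.Complexity.HiraharaMachineParams
import HarnessLib

/-!
# The machine of Hirahara's reduction, III: the greedy-code designs on codes

Topic `Computability/Complexity`. The greedy lexicographic code `lexWords n b d`
(`MetaComplexity/NWLexicodeDesigns.lean`; behind `linDesign`, `MetaComplexity/NWLexicodeLinear.lean`,
used twice by `HiraharaInstance.lean`: the amplification designs `eA` with `b = 16` and the
Nisan–Wigderson design `E` with `b = 4^{140}`) mirrored on digit lists: `digitsT`, `candsT`,
`agreeT`, `lexStepT`, `lexWordsT`, with `lexWordsT n b d = (lexWords n b d).map digits`
(`lexWordsT_eq`), and computed on codes from a unary budget dominating `bⁿ` (`codeFP_lexWordsCap`).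

## References

* S. Arora, B. Barak, *Computational Complexity: A Modern Approach*, CUP 2009, Lemma 20.14
  (greedy designs), §1.3 [AroraBarakCC2009].
* S. Hirahara, *NP-hardness of learning programs and partial MCSP*, ECCC TR22-119, Prop. 6.2 and
  proof of Lemma 8.1/8.3 [Hirahara2022PartialMCSP].
-/

namespace Literature.Computability.Complexity

open Finset
open _root_.Computability Polynomial
open Literature.Computability.MetaComplexity (lexStep lexicode cands lexWords agree)
open CSPToCMMSAMachine (TO toE)
open CodeFP

namespace HiraharaMachine

/-! ### Digit lists -/

/-- The `n` little-endian base-`b` digits of `i`. [folklore] -/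
def digitsT (b n i : ℕ) : List ℕ := (List.range n).map fun k => i / b ^ k % b

/-- The digit list of a word. [folklore] -/
def wordT {n b : ℕ} (g : Fin n → Fin b) : List ℕ := List.ofFn fun k => (g k).val

/-- `wordT` is injective. [folklore] -/
theorem wordT_injective {n b : ℕ} : Function.Injective (wordT (n := n) (b := b)) := by
  intro g g' h
  funext k
  have := congrArg (fun l : List ℕ => l.getD k.val 0) h
  simp only [wordT, List.getD_eq_getElem?_getD, List.getElem?_ofFn, Fin.is_lt k, dif_pos, Option.getD_some, Fin.eta] at this
  exact Fin.ext this

/-- The length of a word's digit list. [folklore] -/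
@[simp] theorem length_wordT {n b : ℕ} (g : Fin n → Fin b) : (wordT g).length = n := by simp [wordT]

/-- The canonical candidates as digit lists. [folklore] -/
def candsT (n b : ℕ) : List (List ℕ) := (List.range (b ^ n)).map (digitsT b n)

/-- The digits of `finFunctionFinEquiv.symm`. [folklore] -/
theorem wordT_symm {n b : ℕ} (i : Fin (b ^ n)) : wordT (finFunctionFinEquiv.symm i) = digitsT b n i := by
  unfold wordT digitsT
  rw [List.ofFn_eq_map]
  apply List.ext_getElem
  · simp
  · intro k h1 h2
    simp only [List.getElem_map, List.getElem_finRange, List.getElem_range]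
    rfl

/-- `candsT = cands` through `wordT`. [folklore] -/
theorem candsT_eq (n b : ℕ) : candsT n b = (cands n b).map wordT := by
  unfold candsT MetaComplexity.cands
  rw [List.map_ofFn, List.ofFn_eq_map]
  apply List.ext_getElem
  · simp
  · intro k h1 h2
    simp only [List.getElem_map, List.getElem_range, List.getElem_finRange, Function.comp_apply]
    rw [wordT_symm]; rfl

/-! ### Agreement -/

/-- The number of agreeing positions of two digit lists. [folklore] -/
def agreeT (u v : List ℕ) : ℕ := ((List.zipWith (fun a c => decide (a = c)) u v).filter id).length

/-- Counting `true`s of an `ofFn` list. [folklore] -/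
private theorem length_filter_id_ofFn {n : ℕ} (p : Fin n → Bool) :
    ((List.ofFn p).filter id).length = (univ.filter fun k => p k = true).card := by
  induction n with
  | zero => simp
  | succ n ih =>
    rw [List.ofFn_succ, List.filter_cons]
    have hs : (univ.filter fun k : Fin (n + 1) => p k = true).card =
        (if p 0 = true then 1 else 0) + (univ.filter fun k : Fin n => p k.succ = true).card := by
      rw [Fin.univ_succ, Finset.filter_cons]
      by_cases h0 : p 0 = true
      · rw [if_pos h0, Finset.card_cons, Finset.filter_map, Finset.card_map]
        simp [h0, add_comm]
      · rw [if_neg h0, Finset.filter_map, Finset.card_map]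
        simp [h0]
    rw [hs, ← ih]
    cases p 0 <;> simp [add_comm]

/-- `agreeT` on words is `agree`. [folklore] -/
theorem agreeT_wordT {n b : ℕ} (g g' : Fin n → Fin b) : agreeT (wordT g) (wordT g') = agree g g' := by
  unfold agreeT wordT MetaComplexity.agree
  have hz : List.zipWith (fun a c => decide (a = c)) (List.ofFn fun k => (g k).val) (List.ofFn fun k => (g' k).val) =
      List.ofFn fun k => decide (g k = g' k) := by
    apply List.ext_getElem
    · simp
    · intro k h1 h2
      simp [List.getElem_zipWith, Fin.ext_iff]
  rw [hz, length_filter_id_ofFn]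
  congr 1; ext k; simp

/-! ### The greedy step and the greedy code -/

/-- The greedy step on digit lists. [cite: AroraBarakCC2009, Lemma 20.14] -/
def lexStepT (d : ℕ) (acc : List (List ℕ)) (c : List ℕ) : List (List ℕ) :=
  if acc.all fun g => decide (agreeT c g ≤ d) then acc ++ [c] else acc

/-- The greedy step commutes with `wordT`. [folklore] -/
theorem lexStepT_map {n b : ℕ} (d : ℕ) (acc : List (Fin n → Fin b)) (c : Fin n → Fin b) :
    lexStepT d (acc.map wordT) (wordT c) = (lexStep d acc c).map wordT := by
  unfold lexStepT MetaComplexity.lexStep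
  have hc : (acc.map wordT).all (fun g => decide (agreeT (wordT c) g ≤ d)) = decide (∀ g ∈ acc, agree c g ≤ d) := by
    rw [List.all_map]
    rw [Bool.eq_iff_iff, List.all_eq_true, decide_eq_true_iff]
    simp [agreeT_wordT]
  rw [hc]
  by_cases h : ∀ g ∈ acc, agree c g ≤ d
  · rw [decide_eq_true h, if_pos rfl, if_pos h, List.map_append]; rfl
  · rw [if_neg h, if_neg (by simpa using h)]

/-- The greedy fold commutes with `wordT`. [folklore] -/
theorem foldl_lexStepT_map {n b : ℕ} (d : ℕ) : ∀ (cs : List (Fin n → Fin b)) (acc : List (Fin n → Fin b)),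
    (cs.map wordT).foldl (lexStepT d) (acc.map wordT) = (cs.foldl (lexStep d) acc).map wordT
  | [], acc => rfl
  | c :: cs, acc => by
    rw [List.map_cons, List.foldl_cons, List.foldl_cons, lexStepT_map, foldl_lexStepT_map d cs]

/-- **The greedy code on digit lists.** [cite: AroraBarakCC2009, Lemma 20.14] -/
def lexWordsT (n b d : ℕ) : List (List ℕ) := (candsT n b).foldl (lexStepT d) []

/-- **`lexWordsT` is `lexWords` read as digit lists.** [folklore] -/
theorem lexWordsT_eq (n b d : ℕ) : lexWordsT n b d = (lexWords n b d).map wordT := by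
  unfold lexWordsT MetaComplexity.lexWords MetaComplexity.lexicode
  rw [candsT_eq, ← foldl_lexStepT_map d (cands n b) []]; rfl

/-- The `i`-th greedy word as a digit list. [folklore] -/
theorem getD_lexWordsT {n b d : ℕ} {i : ℕ} (h : i < (lexWords n b d).length) :
    (lexWordsT n b d).getD i [] = wordT ((lexWords n b d)[i]) := by
  rw [lexWordsT_eq, List.getD_eq_getElem _ _ (by simpa using h), List.getElem_map]

/-- A digit of the `i`-th greedy word. [folklore] -/
theorem getD_getD_lexWordsT {n b d : ℕ} {i : ℕ} (h : i < (lexWords n b d).length) (k : Fin n) :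
    ((lexWordsT n b d).getD i []).getD k.val 0 = ((lexWords n b d)[i] k).val := by
  rw [getD_lexWordsT h, wordT, List.getD_eq_getElem _ _ (by simp), List.getElem_ofFn]

/-- The capped greedy code: candidates below `min bⁿ u`. [folklore] -/
def lexWordsCapT (u n b d : ℕ) : List (List ℕ) := ((List.range (min (b ^ n) u)).map (digitsT b n)).foldl (lexStepT d) []

/-- Beyond the cap, the capped greedy code is the greedy code. [folklore] -/
theorem lexWordsCapT_eq {u n b d : ℕ} (hu : b ^ n ≤ u) : lexWordsCapT u n b d = lexWordsT n b d := by
  unfold lexWordsCapT lexWordsT candsT; rw [min_eq_left hu]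

/-! ### The greedy code on codes -/

/-- The greedy fold only keeps candidates: the result is a sublist of `acc ++ l`. [folklore] -/
theorem foldl_lexStepT_sublist (d : ℕ) : ∀ (l : List (List ℕ)) (acc : List (List ℕ)),
    (l.foldl (lexStepT d) acc).Sublist (acc ++ l)
  | [], acc => by simp
  | c :: l, acc => by
    rw [List.foldl_cons]
    refine (foldl_lexStepT_sublist d l _).trans ?_
    have h : (lexStepT d acc c).Sublist (acc ++ [c]) := by
      unfold lexStepT; split
      · exact List.Sublist.refl _
      · exact List.sublist_append_left _ _
    simpa using h.append_right l

/-- `agreeT` on codes. [folklore] -/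
theorem codeFP_agreeT : CodeFP (pairE (rawE natE) (rawE natE)) unE (fun p => agreeT p.1 p.2) := by
  have hz : CodeFP (pairE unitE (pairE (rawE natE) (rawE natE))) (rawE bitE)
      (fun p => List.zipWith (fun a c => decide (a = c)) p.2.1 p.2.2) :=
    (zipWith (σ := Unit) (eσ := unitE) (g := fun t : Unit × ℕ × ℕ => decide (t.2.1 = t.2.2))
      ((eq natE_injective).comp ((snd _ _).fst'.pair (snd _ _).snd')) :)
  have hz' : CodeFP (pairE (rawE natE) (rawE natE)) (rawE bitE) (fun p => List.zipWith (fun a c => decide (a = c)) p.1 p.2) :=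
    hz.comp ((const _ ()).pair (CodeFP.id _))
  have hf : CodeFP (pairE unitE (rawE bitE)) (rawE bitE) (fun q => q.2.filter fun bit => id bit) :=
    (CodeFP.filter (σ := Unit) (eσ := unitE) (p := fun t : Unit × Bool => t.2) (snd _ _) :)
  have hf' : CodeFP (rawE bitE) (rawE bitE) (fun l => l.filter id) := (hf.comp ((const _ ()).pair (CodeFP.id _))).congr fun _ => rfl
  have h : CodeFP (pairE (rawE natE) (rawE natE)) unE
      (fun p => ((List.zipWith (fun a c => decide (a = c)) p.1 p.2).filter id).length) := ((ulength bitE).comp (hf'.comp hz') :)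
  exact h.congr fun p => by unfold agreeT; rfl

/-- The greedy step on codes, context `d` (unary), arguments `(c, acc)`. [cite: AroraBarakCC2009, Lemma 20.14] -/
theorem codeFP_lexStepT : CodeFP (pairE unE (pairE (rawE natE) (rawE (rawE natE)))) (rawE (rawE natE))
    (fun t => lexStepT t.1 t.2.2 t.2.1) := by
  let cE : ℕ × List ℕ × List (List ℕ) → List Bool := pairE unE (pairE (rawE natE) (rawE (rawE natE)))
  have hd : CodeFP cE unE (fun t => t.1) := fst _ _
  have hc : CodeFP cE (rawE natE) (fun t => t.2.1) := (snd _ _).fst'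
  have hacc : CodeFP cE (rawE (rawE natE)) (fun t => t.2.2) := (snd _ _).snd'
  -- the test on one kept word `g`, context `(d, c)`
  have htest : CodeFP (pairE (pairE unE (rawE natE)) (rawE natE)) bitE (fun q => decide (agreeT q.1.2 q.2 ≤ q.1.1)) :=
    (unLeNat.comp ((codeFP_agreeT.comp ((fst _ _).snd'.pair (snd _ _))).pair (natOfUn.comp (fst _ _).fst')) :)
  have hall : CodeFP cE bitE (fun t => t.2.2.all fun g => decide (agreeT t.2.1 g ≤ t.1)) :=
    ((all htest).comp ((hd.pair hc).pair hacc) :)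
  have h : CodeFP cE (rawE (rawE natE))
      (fun t => if t.2.2.all (fun g => decide (agreeT t.2.1 g ≤ t.1)) then t.2.2 ++ [t.2.1] else t.2.2) :=
    (hall.ite ((rawAppend (rawE natE)).comp (hacc.pair ((rawSingleton (rawE natE)).comp hc))) hacc :)
  exact h.congr fun t => by unfold lexStepT; rfl

/-- The greedy fold on codes, context `d`. [cite: AroraBarakCC2009, Lemma 20.14] -/
theorem codeFP_foldl_lexStepT : CodeFP (pairE unE (rawE (rawE natE))) (rawE (rawE natE))
    (fun p => p.2.foldl (lexStepT p.1) []) := by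
  have h := foldl (σ := ℕ) (eσ := unE) (α := List ℕ) (eα := rawE natE) (β := List (List ℕ)) (eβ := rawE (rawE natE))
    (step := fun d c acc => lexStepT d acc c) (init := fun _ => []) codeFP_lexStepT (const unE []) X (fun d l₁ l₂ => by
      rw [eval_X, pairE_apply, length_boolPair]
      have hsub := foldl_lexStepT_sublist d l₁ []
      rw [List.nil_append] at hsub
      have := length_rawE_le_of_sublist (rawE natE) (hsub.trans (List.sublist_append_left l₁ l₂))
      show (rawE (rawE natE) (l₁.foldl (lexStepT d) [])).length ≤ 2 * (unE d).length + 2 + (rawE (rawE natE) (l₁ ++ l₂)).length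
      omega)
  exact h.congr fun p => rfl

/-- The digits on codes: context `(b, n)` (binary, unary), argument `i` (binary). [folklore] -/
theorem codeFP_digitsT : CodeFP (pairE (pairE natE unE) natE) (rawE natE) (fun p => digitsT p.1.1 p.1.2 p.2) := by
  -- one digit, context `((b, n), i)`, item `k` (binary)
  let cE : (ℕ × ℕ) × ℕ → List Bool := pairE (pairE natE unE) natE
  have hb : CodeFP (pairE cE natE) natE (fun q => q.1.1.1) := (fst _ _).fst'.fst'
  have hn : CodeFP (pairE cE natE) unE (fun q => q.1.1.2) := (fst _ _).fst'.snd'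
  have hi : CodeFP (pairE cE natE) natE (fun q => q.1.2) := (fst _ _).snd'
  have hk : CodeFP (pairE cE natE) unE (fun q => min q.2 q.1.1.2) := (unOfNatMin.comp (hn.pair (snd _ _)) :)
  have hdig : CodeFP (pairE cE natE) natE (fun q => q.1.2 / q.1.1.1 ^ min q.2 q.1.1.2 % q.1.1.1) :=
    (natMod.comp ((natDiv.comp (hi.pair (natPow.comp (hb.pair hk)))).pair hb) :)
  have hmap : CodeFP (pairE cE (rawE natE)) (rawE natE)
      (fun q => q.2.map fun k => q.1.2 / q.1.1.1 ^ min k q.1.1.2 % q.1.1.1) := (map hdig :)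
  have hrange : CodeFP cE (rawE natE) (fun p => List.range p.1.2) := urange.comp (fst _ _).snd'
  have h : CodeFP cE (rawE natE) (fun p => (List.range p.1.2).map fun k => p.2 / p.1.1 ^ min k p.1.2 % p.1.1) :=
    (hmap.comp ((CodeFP.id cE).pair hrange) :)
  exact h.congr fun p => by
    unfold digitsT
    refine List.map_congr_left fun k hk => ?_
    rw [min_eq_left (List.mem_range.1 hk).le]

/-- **The capped greedy code on codes**: `(u, (n, (b, d))) ↦ lexWordsCapT u n b d` (`u, n, d`
unary, `b` binary). [cite: AroraBarakCC2009, Lemma 20.14] -/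
theorem codeFP_lexWordsCap : CodeFP (pairE unE (pairE unE (pairE natE unE))) (rawE (rawE natE))
    (fun p => lexWordsCapT p.1 p.2.1 p.2.2.1 p.2.2.2) := by
  let iE : ℕ × ℕ × ℕ × ℕ → List Bool := pairE unE (pairE unE (pairE natE unE))
  have hu : CodeFP iE unE (fun p => p.1) := fst _ _
  have hn : CodeFP iE unE (fun p => p.2.1) := (snd _ _).fst'
  have hb : CodeFP iE natE (fun p => p.2.2.1) := (snd _ _).snd'.fst'
  have hd : CodeFP iE unE (fun p => p.2.2.2) := (snd _ _).snd'.snd'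
  have hrange : CodeFP iE (rawE natE) (fun p => List.range (min (p.2.2.1 ^ p.2.1) p.1)) :=
    (rangeOf.comp (hu.pair (natPow.comp (hb.pair hn))) :)
  have hcands : CodeFP iE (rawE (rawE natE)) (fun p => (List.range (min (p.2.2.1 ^ p.2.1) p.1)).map (digitsT p.2.2.1 p.2.1)) :=
    ((map (σ := ℕ × ℕ) (eσ := pairE natE unE) (codeFP_digitsT :)).comp ((hb.pair hn).pair hrange) :)
  have h : CodeFP iE (rawE (rawE natE))
      (fun p => ((List.range (min (p.2.2.1 ^ p.2.1) p.1)).map (digitsT p.2.2.1 p.2.1)).foldl (lexStepT p.2.2.2) []) :=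
    (codeFP_foldl_lexStepT.comp (hd.pair hcands) :)
  exact h.congr fun p => by unfold lexWordsCapT; rfl

end HiraharaMachine

end Literature.Computability.Complexity
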